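import Mathlib
import HarnessLib
import Summits.AtomisticToContinuum.FouriersLaw.Theses.JunctionLocality
import Summits.AtomisticToContinuum.FouriersLaw.Theorems.JunctionLocalitySuperadditiveResistanceDeviceLiouville
import Summits.AtomisticToContinuum.FouriersLaw.Theorems.JunctionLocalitySuperadditiveResistanceStubPlainForwardFieldAux1
import Summits.AtomisticToContinuum.FouriersLaw.Theorems.JunctionLocalitySuperadditiveResistanceStubPlainForwardFieldAux3
import Summits.AtomisticToContinuum.FouriersLaw.Theorems.BoundaryEscapeDeficitBoundaryKernelBasics

/-!
# Existence of the plain chain's equilibrium forward field (stub `stub_plainForwardField` of line `floating-probe-bypass-laplacian`, crux stmt-AtomisticToContinuum-11748)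

For the pinned anharmonic chain `pinnedChain ω₂ lam β γ` (all parameters `> 0`), `T > 0` and every
`L ≥ 2` there is a classical forward field of the left bath: `g ∈ C² ∩ L²(μ_T)`, mean zero, with
`L_{T,T} g = −(p_0² − T)` POINTWISE, i.e. `∃ g, g ∈ plainForwardFields ω₂ lam β γ T L`
(`stub_plainForwardField`, with the skeleton's Set-valued vocabulary copied verbatim).

Proof (the hypoelliptic Poisson problem at equilibrium, all inputs PROVED in the tree):
* `g₀ = ∫₀^∞ P_t k dt`, `k = p_0² − T`, for the constructed transition semigroup of the chain at
  equal bath temperatures: `μ_T` is invariant (kernel-level Gibbs invariance,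
  `BondHeatUncertaintySubdiffusiveBondHeatKernelGibbs*`), so Harris' theorem / CEHR Thm 2.13 (3)
  (`pinnedChainSemigroup_ergodic`) gives `|P_t k(z)| ≤ C e^{H(z)/4T} e^{−ct}` once `μ_T(k) = 0`
  (equipartition) — `abs_act_kin_le`; hence `|g₀| ≲ e^{H/4T} ∈ L²(μ_T)`.
* `L g₀ = −k` in `𝓓'` (helper files II–IV: backward Dynkin identity of `ConfinedBackward.lean`,
  energy cutoffs, dominated convergence, `τ → ∞`, Fubini; `ᵗL = L̂ + 2γ`, file I).
* Hörmander's theorem (PROVED in the tree) for `L = X_L² + X_R² + Y`, whose family is bracket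
  generating (CEHR Prop. 4.1 up to the sign of the drift; file I): `g₀` is a.e. a smooth `g̃`, and
  `L g̃ = −k` classically (integration by parts + fundamental lemma; file I).
* `g = g̃ − μ_T(g̃)`.
Uniqueness (not asked) is the landed `forwardField_unique`.

References: Cuneo–Eckmann–Hairer–Rey-Bellet, EJP 23 (2018) no. 55, Thm 2.13, Prop. 4.1;
L. Hörmander, Acta Math. 119 (1967), Thm 1.1.
-/

noncomputable section

open MeasureTheory Filter Topology
open scoped ContDiff
open Literature.MathematicalPhysics.KineticTheory.HeatConduction
open Summit.AtomisticToContinuum.FouriersLaw.Theorems.SuperadditiveResistance.DeviceLiouville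
  (kin deviceGenerator)

namespace Summit.AtomisticToContinuum.FouriersLaw.Cruxes.SuperadditiveResistance.FloatingProbeBypassLaplacian

open scoped NNReal
open Literature.MathematicalPhysics.KineticTheory Literature.Analysis.Distribution OscillatorChain
open Summit.AtomisticToContinuum.FouriersLaw.Theorems.SubdiffusiveBondHeat
open Summit.AtomisticToContinuum.FouriersLaw.Theorems.SuperadditiveResistance.PlainForwardField
open Summit.AtomisticToContinuum.FouriersLaw.Theorems.SuperadditiveResistance.DeviceLiouville (kin_eq_sq)

/-- The set of equilibrium forward fields of the LEFT bath of the plain `L`-chain: classical mean-zero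
`C² ∩ L²(μ_T)` solutions of `L_{T,T} g = −(p_0² − T)`. -/
def plainForwardFields (ω₂ lam β γ T : ℝ) (L : ℕ) : Set (PhaseSpace L → ℝ) :=
  {g | ContDiff ℝ 2 g ∧ MemLp g 2 ((pinnedChain ω₂ lam β γ).gibbsMeasure L T) ∧
    ∫ x, g x ∂((pinnedChain ω₂ lam β γ).gibbsMeasure L T) = 0 ∧
    ∀ x, (pinnedChain ω₂ lam β γ).generator L T T g x = -(kin L 0 x - T)}

/-! ## Elementary lemmas -/

/-- `∂_{p_i}(f − c) = ∂_{p_i} f`. [folklore] -/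
theorem partialP_sub_const' {L : ℕ} (i : Fin L) (f : PhaseSpace L → ℝ) (c : ℝ) :
    partialP i (fun x => f x - c) = partialP i f := by
  funext x
  simp only [partialP, deriv_sub_const]

/-- `∂_{q_i}(f − c) = ∂_{q_i} f`. [folklore] -/
theorem partialQ_sub_const' {L : ℕ} (i : Fin L) (f : PhaseSpace L → ℝ) (c : ℝ) :
    partialQ i (fun x => f x - c) = partialQ i f := by
  funext x
  simp only [partialQ, deriv_sub_const]

/-- The generator annihilates constants: `L(f − c) = L f`. [folklore] -/
theorem generator_sub_const (P : OscillatorChain) {L : ℕ} (T_L T_R : ℝ) (f : PhaseSpace L → ℝ)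
    (c : ℝ) (x : PhaseSpace L) :
    P.generator L T_L T_R (fun y => f y - c) x = P.generator L T_L T_R f x := by
  simp only [OscillatorChain.generator, partialP_sub_const', partialQ_sub_const']

/-! ## The exponential decay of `P_t(p_0² − T)` at equilibrium -/

section Decay

variable {ω₂ lam β γ : ℝ} (hω : 0 < ω₂) (hl : 0 ≤ lam) (hβ : 0 < β) (hγ : 0 < γ) {L : ℕ} (hL : 0 < L)
  {T : ℝ} (hT : 0 < T)
include hω hl hβ hγ hL hT

/-- **`|P_t(p_0² − T)(z)| ≤ M e^{ϑH(z)} e^{−ct}`** (`ϑ = 1/(4T)`) for the transition kernels of the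
pinned chain at equal bath temperatures: CEHR (2.5) with the limit identified as `μ_T`
(`pinnedChain_exp_convergence_gibbs`: Harris + Gibbs invariance) and equipartition
`∫ (p_0² − T) dμ_T = 0`. [cite: CuneoEckmannHairerReyBellet2018, Thm 2.13 (3)] -/
theorem abs_act_kin_le :
    ∃ M c : ℝ, 0 < c ∧ ∀ (t : ℝ≥0) (z : PhaseSpace L),
      |∫ y, (y.2 ⟨0, hL⟩ ^ 2 - T) ∂((pinnedChain ω₂ lam β γ).langevinKernel L T T t z)| ≤
        M * Real.exp (1 / (4 * T) * (pinnedChain ω₂ lam β γ).hamiltonian L z) * Real.exp (-c * t) := by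
  set P := pinnedChain ω₂ lam β γ with hP
  set ϑ : ℝ := 1 / (4 * T) with hϑ
  have hϑ0 : 0 < ϑ := by positivity
  have hϑ1 : ϑ < 1 / T := by rw [hϑ, div_lt_div_iff₀ (by positivity) hT]; nlinarith
  set K : ℝ := 2 / ϑ + T with hK
  have hK0 : 0 < K := by positivity
  set k : PhaseSpace L → ℝ := fun y => y.2 ⟨0, hL⟩ ^ 2 - T with hk
  have hkc : Continuous k := by rw [hk]; fun_prop
  have hkb : ∀ y, |k y| ≤ K * Real.exp (ϑ * P.hamiltonian L y) := fun y =>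
    abs_sq_momentum_sub_le_exp hω hl hβ.le hϑ0 hT.le y ⟨0, hL⟩
  obtain ⟨C, c, hC, hc, hb⟩ := pinnedChain_exp_convergence_gibbs hω hl hβ hγ hL hT hϑ0 hϑ1
  have h0 : ∫ y, k y ∂(P.gibbsMeasure L T) = 0 :=
    pinnedChain_integral_kinObs_gibbsMeasure hω hl hβ.le γ L hT ⟨0, hL⟩
  refine ⟨K * C, c, hc, fun t z => ?_⟩
  have hfc : Continuous fun y => k y / K := hkc.div_const K
  have hfb : ∀ y, |k y / K| ≤ Real.exp (ϑ * P.hamiltonian L y) := fun y => by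
    rw [abs_div, abs_of_pos hK0, div_le_iff₀ hK0, mul_comm]
    exact hkb y
  have h := hb z t (fun y => k y / K) hfc hfb
  rw [integral_div, integral_div, h0, zero_div, sub_zero,
    ← pinnedChain_langevinKernel_eq_transitionKernel L T T hω hl hβ.le hγ.le t, abs_div,
    abs_of_pos hK0, div_le_iff₀ hK0] at h
  calc |∫ y, k y ∂(P.langevinKernel L T T t z)|
      ≤ C * Real.exp (ϑ * P.hamiltonian L z) * Real.exp (-c * t) * K := h
    _ = K * C * Real.exp (1 / (4 * T) * P.hamiltonian L z) * Real.exp (-c * t) := by rw [hϑ]; ring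

/-- **The forward field of the left bath, all properties except the mean**: a smooth `g̃ ∈ L²(μ_T)`
with `L_{T,T} g̃ = −(p_0² − T)` pointwise (semigroup potential `∫₀^∞ P_t k dt`, its distributional
Poisson equation, Hörmander regularity, classical equation, `e^{H/4T}`-domination).
[cite: CuneoEckmannHairerReyBellet2018, Thm 2.13] [cite: Hormander1967, Thm 1.1] -/
theorem exists_smooth_forwardField :
    ∃ g : PhaseSpace L → ℝ, ContDiff ℝ ∞ g ∧ MemLp g 2 ((pinnedChain ω₂ lam β γ).gibbsMeasure L T) ∧
      ∀ x, (pinnedChain ω₂ lam β γ).generator L T T g x = -(x.2 ⟨0, hL⟩ ^ 2 - T) := by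
  haveI := isAddHaarMeasure_volume_phaseSpace L
  set P := pinnedChain ω₂ lam β γ with hP
  have hU : ContDiff ℝ ∞ P.U := pinnedChain_contDiff_U ω₂ lam β γ
  have hV : ContDiff ℝ ∞ P.V := pinnedChain_contDiff_V ω₂ lam β γ
  have hγ' : P.γ = γ := rfl
  have hγT : 0 ≤ P.γ * T := by rw [hγ']; positivity
  set ϑ : ℝ := 1 / (4 * T) with hϑ
  have hϑ0 : 0 < ϑ := by positivity
  have hϑ1 : ϑ < 1 / T := by rw [hϑ, div_lt_div_iff₀ (by positivity) hT]; nlinarith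
  have h2ϑ : 2 * ϑ < 1 / T := by
    rw [hϑ, show 2 * (1 / (4 * T)) = 1 / (2 * T) by field_simp; ring, div_lt_div_iff₀ (by positivity) hT]
    nlinarith
  set K : ℝ := 2 / ϑ + T with hK
  set k : PhaseSpace L → ℝ := fun y => y.2 ⟨0, hL⟩ ^ 2 - T with hk
  have hks : ContDiff ℝ ∞ k := by rw [hk]; fun_prop
  have hkc : Continuous k := hks.continuous
  have hkb : ∀ y, |k y| ≤ K * Real.exp (ϑ * P.hamiltonian L y) := fun y =>
    abs_sq_momentum_sub_le_exp hω hl hβ.le hϑ0 hT.le y ⟨0, hL⟩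
  obtain ⟨M, c, hc, hdecay⟩ := abs_act_kin_le hω hl hβ hγ hL hT
  set Hm := P.hamiltonian L with hHm
  have hHc : Continuous Hm := pinnedChain_continuous_hamiltonian ω₂ lam β γ L
  -- the candidate `g₀ = ∫₀^∞ P_t k dt`
  set g₀ : PhaseSpace L → ℝ := fun x => ∫ t in Set.Ioi (0 : ℝ),
    ∫ y, k y ∂(P.langevinKernel L T T t.toNNReal x) with hg₀
  have hg₀m : StronglyMeasurable g₀ := stronglyMeasurable_forwardIntegral hω hl hβ.le hγ.le hkc
  set M' : ℝ := M * ∫ t in Set.Ioi (0 : ℝ), Real.exp (-c * t) with hM'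
  have hg₀b : ∀ x, |g₀ x| ≤ M' * Real.exp (ϑ * Hm x) := fun x =>
    abs_forwardIntegral_le k hc hdecay x
  set B : PhaseSpace L → ℝ := fun x => M' * Real.exp (ϑ * Hm x) with hB
  have hBc : Continuous B := by rw [hB]; fun_prop
  have hg₀B : ∀ x, ‖g₀ x‖ ≤ ‖B x‖ := fun x => by
    rw [Real.norm_eq_abs, Real.norm_eq_abs]
    exact (hg₀b x).trans (le_abs_self _)
  have hg₀loc : LocallyIntegrable g₀ volume :=
    hBc.locallyIntegrable.mono hg₀m.aestronglyMeasurable (Eventually.of_forall hg₀B)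
  -- the Poisson equation in `𝓓'`
  have hweak₀ : ∀ φ : PhaseSpace L → ℝ, ContDiff ℝ ∞ φ → HasCompactSupport φ →
      ∫ x, g₀ x * hormanderTranspose (P.drift L) (P.bathField hL T T) (fun _ => 0) φ x =
        ∫ x, (-k x) * φ x := by
    intro φ hφ hφc
    have h := integral_transpose_mul_forwardIntegral hω hl hβ.le hγ.le hL hT hϑ0 hϑ1 hc hks hkb hdecay hφ hφc
    calc ∫ x, g₀ x * hormanderTranspose (P.drift L) (P.bathField hL T T) (fun _ => 0) φ x
        = ∫ x, (sdeGenerator (fun y => -P.drift L y) (P.bathVecL L T) (P.bathVecR L T) φ x +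
            2 * γ * φ x) * g₀ x := by
          refine integral_congr_ae (ae_of_all _ fun x => ?_)
          dsimp only
          rw [hormanderTranspose_generatorFamily_eq_revGenerator P hU hV hL hγT hγT hφ x, hγ', mul_comm]
      _ = -∫ x, φ x * k x := h
      _ = ∫ x, (-k x) * φ x := by
          rw [← integral_neg]
          exact integral_congr_ae (ae_of_all _ fun x => by ring)
  -- hypoelliptic regularity
  obtain ⟨g, hg, hae⟩ := exists_smooth_ae_eq_of_weak_poisson hβ.le hγ hL hT hg₀loc hks.neg hweak₀
  have hweak : ∀ φ : PhaseSpace L → ℝ, ContDiff ℝ ∞ φ → HasCompactSupport φ →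
      ∫ x, g x * hormanderTranspose (P.drift L) (P.bathField hL T T) (fun _ => 0) φ x =
        ∫ x, (-k x) * φ x := by
    intro φ hφ hφc
    rw [← hweak₀ φ hφ hφc]
    refine integral_congr_ae ?_
    filter_upwards [hae] with x hx
    rw [hx]
  have hclass : ∀ x, P.generator L T T g x = -k x :=
    generator_eq_of_weak_poisson P hU hV hL hγT hγT hg hkc.neg hweak
  -- square integrability for `μ_T`
  set μ := P.gibbsMeasure L T with hμ
  haveI : IsProbabilityMeasure μ := pinnedChain_isProbabilityMeasure_gibbsMeasure hω hl hβ.le γ L hT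
  have haeμ : g₀ =ᵐ[μ] g := (P.gibbsMeasure_absolutelyContinuous L T).ae_le hae
  have hBL2 : MemLp B 2 μ := by
    rw [memLp_two_iff_integrable_sq hBc.aestronglyMeasurable]
    have h2 := pinnedChain_integrable_exp_mul_hamiltonian_gibbsMeasure hω hl hβ.le γ L hT h2ϑ
    refine (h2.const_mul (M' ^ 2)).congr (Eventually.of_forall fun x => ?_)
    have e : (M' * Real.exp (ϑ * Hm x)) ^ 2 = M' ^ 2 * Real.exp (2 * ϑ * Hm x) := by
      rw [mul_pow, ← Real.exp_nat_mul]; ring_nf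
    show M' ^ 2 * Real.exp (2 * ϑ * Hm x) = (M' * Real.exp (ϑ * Hm x)) ^ 2
    rw [e]
  have hgL2 : MemLp g 2 μ := by
    refine hBL2.of_le hg.continuous.aestronglyMeasurable ?_
    filter_upwards [haeμ] with x hx
    rw [← hx]
    exact hg₀B x
  exact ⟨g, hg, hgL2, hclass⟩

end Decay

/-! ## The registered stub -/

/-- **S0a (fixed-`N`, size L).** Existence of the plain chain's equilibrium forward field of the left bath for
every `L ≥ 2`: a classical mean-zero `C² ∩ L²(μ_T)` solution of `L_{T,T} g = −(p_0² − T)` for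
`pinnedChain ω₂ lam β γ` (all `> 0`), `T > 0`. Content: the hypoelliptic Poisson problem at equilibrium
(`g = ∫₀^∞ P_t(p_0² − T) dt` by exponential convergence of the equilibrium semigroup, Cuneo–Eckmann–Hairer–
Rey-Bellet 2018 Thm 2.13(3), and `C^∞` by Hörmander's theorem, both PROVED in the tree), recentered.
[cite: CuneoEckmannHairerReyBellet2018, Thm 2.13] [cite: Hormander1967, Thm 1.1] -/
theorem stub_plainForwardField :
    ∀ ω₂ lam β γ T : ℝ, 0 < ω₂ → 0 < lam → 0 < β → 0 < γ → 0 < T →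
      ∀ L : ℕ, 2 ≤ L → ∃ g : PhaseSpace L → ℝ, g ∈ plainForwardFields ω₂ lam β γ T L := by
  intro ω₂ lam β γ T hω hlam hβ hγ hT L hL2
  have hL : 0 < L := by omega
  obtain ⟨g, hg, hgL2, hclass⟩ := exists_smooth_forwardField hω hlam.le hβ hγ hL hT
  set P := pinnedChain ω₂ lam β γ with hP
  set μ := P.gibbsMeasure L T with hμ
  haveI : IsProbabilityMeasure μ := pinnedChain_isProbabilityMeasure_gibbsMeasure hω hlam.le hβ.le γ L hT
  set c₀ : ℝ := ∫ x, g x ∂μ with hc₀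
  refine ⟨fun x => g x - c₀, ?_, ?_, ?_, ?_⟩
  · exact (hg.sub contDiff_const).of_le (by norm_cast)
  · exact hgL2.sub (memLp_const c₀)
  · have hgi : Integrable g μ := hgL2.integrable (by norm_num)
    rw [integral_sub hgi (integrable_const c₀), integral_const]
    simp [probReal_univ, hc₀]
  · intro x
    rw [generator_sub_const, hclass x, kin_eq_sq hL]

end Summit.AtomisticToContinuum.FouriersLaw.Cruxes.SuperadditiveResistance.FloatingProbeBypassLaplacian

end
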